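import Summits.CriticalPhenomena.PercolationContinuityZ3.Theorems.PercNearOneGluingNoHeavyLowerTailFourCopyHubTriA
import HarnessLib

/-! — part 2: lookup lemmas, the leaf bound, the assembled tables in specification form
# `NoHeavyLowerTail` (stmt-CriticalPhenomena-4575) — FOUR-copy switching certificates, VIII: the TRIANGLE bound
# (two-step programs on all pairs of target copies), its soundness, and the `E₃` conclusion from a computed bound

Support file (prover prim-ineq-prove-3 gen 8; `--supports stmt-CriticalPhenomena-4575`).  No named facts, no sorries.

The certificates of gen 6 (referee-verified for all finite graphs in the compute lane) use ALL 72 two-step programs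
`u → T₁ ; v → T₂` (`{T₁,T₂} ⊆ {1,2,3}`), including those with target set `{1,2}`, which couple the two side copies.  For a
weakly well-formed certificate `c` (`Cert.wfT`: no hub condition) the bound of this file is
`VT c πX t₁ t₂ t₃ = max over the refined states s₁ of copy 1 and s₃ of copy 3 of F(s₁,s₃) + Σ_w max_{p ∈ opts(t₂,w)} G_w(p; s₁,s₃)`:
given `s₁` and `s₃`, copy `2` and its `X`-blocks decouple (every program reads at most one root letter of copy `2`).  The
per-source-type tables (`mkTriTabs`) are plain integer tables of `e1`/`e2` (no packing: this bound is meant to be EVALUATED —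
`decide` by compiled evaluation — not reduced by the kernel; ≈ 10⁹ elementary operations for the full certificate).
SOUNDNESS (`Sreal_le_VT`): `Sreal c τ x ≤ VT c (type x₀) (type x₁) (type x₂) (type x₃)`.
CONCLUSION (`e3_nonneg_of_triOK`): if `triOK c E D = true` — the symmetrisation of the cell function
`U = Pc + D·Tc − V` is nonnegative at every sorted cell, `V` the table of all `VT` values — then `E₃(A,B,C) ≥ 0` for the
target events on every finite graph (measure preservation `E[S] = E[Pc]`, `S ≤ V(code)`, `E[U(code)] ≥ 0`).
-/

namespace Summit.CriticalPhenomena.PercolationContinuityZ3.Theorems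

namespace FourCopyHub

open Finset Literature.Probability.Percolation Literature.Probability.Percolation.DecisionTree
open Literature.Probability.Percolation.Gladkov ThreePointLB GroupThreePointLB FourPointAtoms SwitchRelax SwitchingK
open scoped Classical

/-! ### Lookup lemmas -/

section Lookups

/-- Array-of-list lookup. [folklore] -/
theorem gA_toArray {α : Type} (L : List α) (i : ℕ) (d : α) : gA L.toArray i d = lk L i d := by
  rw [gA, Array.getD_eq_getD_getElem?, List.getElem?_toArray]; rfl

/-- `rowA` lookup. [this work] -/
theorem gA_rowA (f : Ty → ℤ) (p : Ty) (d : ℤ) : gA (rowA f) p.val d = f p := by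
  rw [rowA, gA_toArray, lk_map_allTys]

/-- `mkA2` lookup. [this work] -/
theorem gA2_mkA2 (f : Fin 4 → Ty → ℤ) (u : Fin 4) (p : Ty) : gA2 (mkA2 f) u.val p.val = f u p := by
  simp only [gA2, mkA2, gA_toArray, lk_map_finRange4, gA_rowA]

/-- `mkA3` lookup. [this work] -/
theorem gA3_mkA3 (n : ℕ) (f : ℕ → Fin 4 → Ty → ℤ) {a : ℕ} (ha : a < n) (u : Fin 4) (p : Ty) :
    gA3 (mkA3 n f) a u.val p.val = f a u p := by
  simp only [gA3, mkA3, gA_toArray, lk_map_range _ _ ha, mkA2, lk_map_finRange4, gA_rowA]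

/-- `mkA4` lookup. [this work] -/
theorem gA4_mkA4 (n : ℕ) (f : Fin 4 → Ty → Ty → ℕ → ℤ) (u : Fin 4) (t p : Ty) {a : ℕ} (ha : a < n) :
    gA4 (mkA4 n f) u.val t.val p.val a = f u t p a := by
  simp only [gA4, mkA4, gA_toArray, lk_map_finRange4, lk_map_allTys, lk_map_range _ _ ha]

variable (c : Cert) (πX : Ty)

/-- The one-step table is `e1`. [this work] -/
theorem lk3_tab1 (q : P1) (p : Ty) {a b : ℕ} (ha : a < c.nA) (hb : b < c.nA) :
    lk3 (tab1 c (CTab c πX) q) p a b = e1 c πX q p a b := by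
  rw [lk3, tab1, lk_map_allTys, lk_map_range _ _ ha, lk_map_range _ _ hb, CTab_lk]; rfl

/-- The two-step table is `e2` at relevant second options. [this work] -/
theorem lk4_tab2 (q : P2) (p1 t p2 : Ty) {a : ℕ} (ha : a < c.nA) (hp : relB πX q.v p2 = true) :
    lk4 (tab2 c (CTab c πX) (MTab c πX) q) p1 t p2 a = e2 c πX q p1 t p2 a := by
  rw [lk4, tab2, lk_map_allTys, lk_map_allTys, lk_map_allTys, lk_map_range _ _ ha, CTab_lk, MTab_lk c πX _ _ _ _ hp]; rfl

/-- Option table lookup. [this work] -/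
theorem otL_mkOT (t : Ty) (w : Fin 4) : otL (mkOT πX) t w = optsF πX t w := by
  rw [otL, mkOT, lk_map_allTys, lk_map_finRange4]

/-- The grouped tables: one-step programs with target `1`, by letter. [this work] -/
theorem o1_eq (u : Fin 4) : lk (mkTriTabs c πX).o1 u.val [] =
    ((c.one.filter fun q => q.T = 1 ∧ rep πX q.u = u).map fun q => tab1 c (CTab c πX) q) := by
  simp only [mkTriTabs, mkTriTabsCM, mkTriTabsAux, lk_map_finRange4, List.filter_map, List.map_map]; rfl

/-- One-step programs with target `2`, by letter. [this work] -/
theorem o2_eq (w : Fin 4) : lk (mkTriTabs c πX).o2 w.val [] =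
    ((c.one.filter fun q => q.T = 2 ∧ rep πX q.u = w).map fun q => tab1 c (CTab c πX) q) := by
  simp only [mkTriTabs, mkTriTabsCM, mkTriTabsAux, lk_map_finRange4, List.filter_map, List.map_map]; rfl

/-- One-step programs with target `3`. [this work] -/
theorem o3_eq : (mkTriTabs c πX).o3 = ((c.one.filter fun q => q.T = 3).map fun q => (tab1 c (CTab c πX) q, rep πX q.u)) := by
  simp only [mkTriTabs, mkTriTabsCM, mkTriTabsAux, List.filter_map, List.map_map]; rfl

/-- Programs `u' → 1 ; v → 3`, by first letter. [this work] -/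
theorem p13_eq (u : Fin 4) : lk (mkTriTabs c πX).p13 u.val [] =
    ((c.two.filter fun q => q.T1 = 1 ∧ q.T2 = 3 ∧ rep πX q.u = u).map fun q => (tab2 c (CTab c πX) (MTab c πX) q, rep πX q.v)) := by
  simp only [mkTriTabs, mkTriTabsCM, mkTriTabsAux, lk_map_finRange4, List.filter_map, List.map_map]; rfl

/-- Programs `u' → 3 ; v → 1`, by second letter. [this work] -/
theorem p31_eq (u : Fin 4) : lk (mkTriTabs c πX).p31 u.val [] =
    ((c.two.filter fun q => q.T1 = 3 ∧ q.T2 = 1 ∧ rep πX q.v = u).map fun q => (tab2 c (CTab c πX) (MTab c πX) q, rep πX q.u)) := by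
  simp only [mkTriTabs, mkTriTabsCM, mkTriTabsAux, lk_map_finRange4, List.filter_map, List.map_map]; rfl

/-- Programs `u' → 2 ; v → 3`, by first letter. [this work] -/
theorem p23_eq (w : Fin 4) : lk (mkTriTabs c πX).p23 w.val [] =
    ((c.two.filter fun q => q.T1 = 2 ∧ q.T2 = 3 ∧ rep πX q.u = w).map fun q => (tab2 c (CTab c πX) (MTab c πX) q, rep πX q.v)) := by
  simp only [mkTriTabs, mkTriTabsCM, mkTriTabsAux, lk_map_finRange4, List.filter_map, List.map_map]; rfl

/-- Programs `u' → 3 ; v → 2`, by second letter. [this work] -/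
theorem p32_eq (w : Fin 4) : lk (mkTriTabs c πX).p32 w.val [] =
    ((c.two.filter fun q => q.T1 = 3 ∧ q.T2 = 2 ∧ rep πX q.v = w).map fun q => (tab2 c (CTab c πX) (MTab c πX) q, rep πX q.u)) := by
  simp only [mkTriTabs, mkTriTabsCM, mkTriTabsAux, lk_map_finRange4, List.filter_map, List.map_map]; rfl

/-- Programs `u' → 1 ; v → 2`, by both letters. [this work] -/
theorem p12_eq (u w : Fin 4) : lk (lk (mkTriTabs c πX).p12 u.val []) w.val [] =
    ((c.two.filter fun q => q.T1 = 1 ∧ q.T2 = 2 ∧ rep πX q.u = u ∧ rep πX q.v = w).map fun q => tab2 c (CTab c πX) (MTab c πX) q) := by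
  simp only [mkTriTabs, mkTriTabsCM, mkTriTabsAux, lk_map_finRange4, List.filter_map, List.map_map]; rfl

/-- Programs `u' → 2 ; v → 1`, by both letters. [this work] -/
theorem p21_eq (w u : Fin 4) : lk (lk (mkTriTabs c πX).p21 w.val []) u.val [] =
    ((c.two.filter fun q => q.T1 = 2 ∧ q.T2 = 1 ∧ rep πX q.u = w ∧ rep πX q.v = u).map fun q => tab2 c (CTab c πX) (MTab c πX) q) := by
  simp only [mkTriTabs, mkTriTabsCM, mkTriTabsAux, lk_map_finRange4, List.filter_map, List.map_map]; rfl

end Lookups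

/-! ### The leaf: what `triMax` dominates -/

section Leaf

/-- Lookup in a mapped list with a matching default. [folklore] -/
theorem lk_map_fdefault {α β : Type} (L : List α) (f : α → β) (i : ℕ) (d : α) : lk (L.map f) i (f d) = f (lk L i d) := by
  simp only [lk, List.getElem?_map]
  cases L[i]? <;> rfl

/-- Columns after fixing a letter: the list of columns is mapped. [this work] -/
theorem lk_addCols (u : Fin 4) (p : Ty) (G : List (List (ℤ × Array (Array ℤ)))) (w : ℕ) :
    lk (addCols u p G) w [] = addCol u p (lk G w []) := by
  have h := lk_map_fdefault G (addCol u p) w []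
  rw [addCols, ← h]; rfl

/-- `zip` of two maps of one list. [folklore] -/
theorem zip_map_map' {α β γ : Type} (L : List α) (f : α → β) (g : α → γ) :
    List.zip (L.map f) (L.map g) = L.map fun a => (f a, g a) := by
  induction L with
  | nil => rfl
  | cons a L ih => simp [ih]

/-- **Column bound.**  For a column built from an option list `L` as `zip (L.map b) (L.map h)` and an option `p ∈ L`,
after fixing the letters `0,1,2` to `p₀,p₁,p₂`, the best value with letter `3` at `p₃` dominates the entry of `p`. [this work] -/
theorem colBest_ge {L : List Ty} (b : Ty → ℤ) (h : Ty → Array (Array ℤ)) {p : Ty} (hp : p ∈ L) (p0 p1 p2 p3 : Ty) :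
    b p + gA2 (h p) (0 : Fin 4).val p0.val + gA2 (h p) (1 : Fin 4).val p1.val + gA2 (h p) (2 : Fin 4).val p2.val
      + gA2 (h p) (3 : Fin 4).val p3.val ≤
      colBest p3 (addCol 2 p2 (addCol 1 p1 (addCol 0 p0 (List.zip (L.map b) (L.map h))))) := by
  rw [zip_map_map', colBest]
  refine le_lmax (List.mem_map.2 ⟨(b p + gA2 (h p) (0 : Fin 4).val p0.val + gA2 (h p) (1 : Fin 4).val p1.val
    + gA2 (h p) (2 : Fin 4).val p2.val, h p), ?_, rfl⟩)
  simp only [addCol, List.map_map, List.mem_map, Function.comp]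
  exact ⟨p, hp, rfl⟩

/-- **Leaf bound.**  `triMax` dominates the value of any admissible choice of the four letter options. [this work] -/
theorem triMax_ge {O0 O1 O2 O3 : List Ty} (F0 : ℤ) (Atab : Array (Array ℤ)) (G : List (List (ℤ × Array (Array ℤ))))
    {p0 p1 p2 p3 : Ty} (h0 : p0 ∈ O0) (h1 : p1 ∈ O1) (h2 : p2 ∈ O2) (h3 : p3 ∈ O3) :
    F0 + gA2 Atab (0 : Fin 4).val p0.val + gA2 Atab (1 : Fin 4).val p1.val + gA2 Atab (2 : Fin 4).val p2.val
      + gA2 Atab (3 : Fin 4).val p3.val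
      + ((List.finRange 4).map fun w => colBest p3 (lk (addCols 2 p2 (addCols 1 p1 (addCols 0 p0 G))) w.val [])).sum
      ≤ triMax O0 O1 O2 O3 F0 Atab G := by
  unfold triMax
  refine le_trans ?_ (le_lmax (List.mem_map.2 ⟨p0, h0, rfl⟩))
  refine le_trans ?_ (le_lmax (List.mem_map.2 ⟨p1, h1, rfl⟩))
  refine le_trans ?_ (le_lmax (List.mem_map.2 ⟨p2, h2, rfl⟩))
  refine le_trans (le_of_eq ?_) (le_lmax (List.mem_map.2 ⟨p3, h3, rfl⟩))
  ring

end Leaf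

/-! ### The assembled tables in specification form -/

section Spec

/-- The specification value of a pair of side/hub states with copy-2 letter options `s₂`:
`F0 + Σ_u A(u, s₁ u) + Σ_w [G0(w, s₂ w) + Σ_u H(w, u, s₂ w, s₁ u)]`. [this work] -/
def specVal (c : Cert) (P : TriTabs) (t1 t2 t3 : Ty) (s3 s1 s2 : St4) : ℤ :=
  triF0 c P t1 t2 s3 + ((List.finRange 4).map fun u => triA c P t1 t2 t3 s3 u (s1 u)).sum
    + ((List.finRange 4).map fun w => triG0 c P t1 t2 t3 s3 w (s2 w)
        + ((List.finRange 4).map fun u => triH c P t1 t2 t3 w u (s2 w) (s1 u)).sum).sum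

variable {c : Cert} (hA : ∀ t, c.cls2 t < c.nA)
include hA

/-- The copy-1 letter table is `triA`. [this work] -/
theorem aRows_spec (P : TriTabs) {t1 t2 t3 : Ty} {s3 : St4} (u : Fin 4) (p1 : Ty) :
    gA2 (gA (gA (aRows (triO1 c P t3) (mkS3Parts c P t3 s3) c.nA) t1.val #[]) (c.cls2 t2) #[]) u.val p1.val
      = triA c P t1 t2 t3 s3 u p1 := by
  simp only [aRows, gA2, gA_toArray, lk_map_allTys, lk_map_range _ _ (hA t2), lk_map_finRange4, gA_rowA, triO1,
    mkS3Parts, gA3_mkA3 _ _ (hA t2), gA4_mkA4 _ _ _ _ _ (hA t2), triA]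

/-- The copy-2 column bases are `triG0`. [this work] -/
theorem gBase_spec (P : TriTabs) (OT : List (List (List Ty))) {t1 t2 t3 : Ty} {s3 : St4} (w : Fin 4) :
    gA (gA (gA ((allTys.map fun t2 => gBase OT (triO2 c P t3) (mkS3Parts c P t3 s3) c.nA t2).toArray) t2.val #[])
      (c.cls2 t1) #[]) w.val [] = (otL OT t2 w).map fun p => triG0 c P t1 t2 t3 s3 w p := by
  simp only [gBase, gA_toArray, lk_map_allTys, lk_map_range _ _ (hA t1), lk_map_finRange4, triO2, mkS3Parts,
    gA3_mkA3 _ _ (hA t1), gA4_mkA4 _ _ _ _ _ (hA t1), triG0]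

omit hA in
/-- The coupling columns are `triH` rows. [this work] -/
theorem triHall_spec (c : Cert) (P : TriTabs) (OT : List (List (List Ty))) (t1 t2 t3 : Ty) (w : Fin 4) :
    lk (lk (lk (triHall c P OT t3) t1.val []) t2.val []) w.val [] =
      (otL OT t2 w).map fun p => mkA2 fun u p1 => triH c P t1 t2 t3 w u p p1 := by
  simp only [triHall, lk_map_allTys, lk_map_finRange4]

/-- **Row entry ≥ specification value** for admissible letter options (`s₁ u ∈ opts(t₁,u)`, `s₂ w ∈ opts(t₂,w)`). [this work] -/
theorem specVal_le_row (P : TriTabs) (πX t1 t2 t3 : Ty) (s3 : St4) {s1 s2 : St4} (h1 : ∀ u, s1 u ∈ optsF πX t1 u)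
    (h2 : ∀ w, s2 w ∈ optsF πX t2 w) :
    specVal c P t1 t2 t3 s3 s1 s2 ≤
      lk (lk (triRows c P (mkOT πX) t3 (triHall c P (mkOT πX) t3) (triO1 c P t3) (triO2 c P t3) s3) t1.val []) t2.val bot := by
  rw [triRows]
  simp only [triRowsAux, lk_map_allTys]
  have hO : ∀ t w, otL (mkOT πX) t w = optsF πX t w := otL_mkOT πX
  refine le_trans ?_ (triMax_ge _ _ _ (by rw [hO]; exact h1 0) (by rw [hO]; exact h1 1) (by rw [hO]; exact h1 2)
    (by rw [hO]; exact h1 3))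
  rw [specVal, aRows_spec hA, aRows_spec hA, aRows_spec hA, aRows_spec hA]
  have hcol : ∀ w : Fin 4,
      triG0 c P t1 t2 t3 s3 w (s2 w) + ((List.finRange 4).map fun u => triH c P t1 t2 t3 w u (s2 w) (s1 u)).sum ≤
      colBest (s1 3) (lk (addCols 2 (s1 2) (addCols 1 (s1 1) (addCols 0 (s1 0)
        ((List.finRange 4).map fun w => List.zip
          (gA (gA (gA ((allTys.map fun t2 => gBase (mkOT πX) (triO2 c P t3) (mkS3Parts c P t3 s3) c.nA t2).toArray)
            t2.val #[]) (c.cls2 t1) #[]) w.val [])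
          (lk (lk (lk (triHall c P (mkOT πX) t3) t1.val []) t2.val []) w.val []))))) w.val []) := fun w => by
    rw [lk_addCols, lk_addCols, lk_addCols, lk_map_finRange4, gBase_spec hA, triHall_spec]
    refine le_trans (le_of_eq ?_) (colBest_ge _ _ (by rw [hO]; exact h2 w) (s1 0) (s1 1) (s1 2) (s1 3))
    rw [gA2_mkA2, gA2_mkA2, gA2_mkA2, gA2_mkA2, sum_map_finRange4]
    ring
  have k0 := hcol 0
  have k1 := hcol 1
  have k2 := hcol 2
  have k3 := hcol 3
  simp only [sum_map_finRange4] at k0 k1 k2 k3 ⊢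
  linarith

end Spec

end FourCopyHub

end Summit.CriticalPhenomena.PercolationContinuityZ3.Theorems
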